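import Summits.Parity.GeneralizedHardyLittlewood.Theses.RoughSemiprimeRigidity
import Summits.Parity.GeneralizedHardyLittlewood.Theorems.LiouvilleShiftedTablesPairsToGHLPairSlice

/-!
# STRATEGY-CENSUS companion — crux `RoughSemiprimeTwins` (stmt-Parity-9380): the costume theorems

Route `RoughSemiprimeRigidity` (route-Parity-RoughSemiprimeRigidity), sub-problem `GeneralizedHardyLittlewood`.
Deciding theorem of the route (landed, rev 10):
`closes : TwoSidedRigidity → EH → RoughSemiprimeBombieri → RoughSemiprimeTwins → WeightedPairsToGHL → GeneralizedHardyLittlewood`.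

This file certifies, sorry-free, that MODULO THE ROUTE'S OWN OTHER LOAD-BEARING BINDERS the deciding crux
`RoughSemiprimeTwins` (rough-semiprime twins have the Hardy–Littlewood count `¼·𝔖({0,h})·N log²N`) is

* at pair level: EQUIVALENT to log-weighted Hardy–Littlewood prime pairs at every even shift
  (`crux_iff_weightedPairsHL : TwoSidedRigidity → EH → RoughSemiprimeBombieri → (RoughSemiprimeTwins ↔ WeightedPairsHL)`,
  where `WeightedPairsHL` is VERBATIM the antecedent of the route's crux `WeightedPairsToGHL`,
  `weightedPairsToGHL_iff : WeightedPairsToGHL ↔ (WeightedPairsHL → GeneralizedHardyLittlewood) := Iff.rfl`);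
* at summit level: EQUIVALENT to the sub-problem statement itself
  (`crux_iff_summit : TwoSidedRigidity → EH → RoughSemiprimeBombieri → WeightedPairsToGHL →
  (RoughSemiprimeTwins ↔ GeneralizedHardyLittlewood)`), using the landed pair slice of GHL
  (`Theorems.PairsToGHL.pairAsymptotic_of_generalizedHardyLittlewood`) upgraded to log weights by an Abel-type
  argument proved here (`abel_logsq`, `weightedPairsHL_of_generalizedHardyLittlewood`).

So the "reduction" offered by the deciding crux is, given the route's other four binders, the summit (resp. its
twin-prime sector) in the costume of rough semiprimes: the route's own mechanism `TwoSidedRigidity` is exactly the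
statement that the rough-semiprime twin cell is an exact copy of the prime twin cell.
[folklore]
-/

namespace Summit.Parity.GeneralizedHardyLittlewood.Cruxes.RoughSemiprimeTwins.StrategyCensus

open Filter Finset Asymptotics
open scoped BigOperators Topology
open Summit.Parity.GeneralizedHardyLittlewood.Theses.RoughSemiprimeRigidity

/-! ## §0 The crux's objects, named (verbatim the `let`s of the route file) -/

/-- The route's log-weighted rough-semiprime weight (`η = ¼`). Verbatim the `let W` of `RoughSemiprimeTwins`.
[folklore] -/
noncomputable def W (m : ℕ) : ℝ :=
  ∑ q ∈ m.primeFactors,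
    if (m / q).Prime ∧ q < m / q ∧ m < q ^ 4 then 2 * Real.log q * Real.log ((m / q : ℕ) : ℝ) else 0

/-- The rough-semiprime twin cell `S_h(N) = Σ_{1 ≤ n ≤ N} W(n) W(n+h)`. [folklore] -/
noncomputable def S (h N : ℕ) : ℝ := ∑ n ∈ Finset.Icc 1 N, W n * W (n + h)

/-- `𝔖({0,h})`, the Hardy–Littlewood pair series (tree definition, by name). [folklore] -/
noncomputable def sing (h : ℕ) : ℝ :=
  Literature.NumberTheory.Sieve.singularSeries ({0, (h : ℤ)} : Finset ℤ)

/-- The log-weighted prime twin sum `U_h(N) = Σ_{1 ≤ n ≤ N} Λ(n) log n · Λ(n+h) log(n+h)` (verbatim the twin sum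
of `TwoSidedRigidity` / `WeightedPairsToGHL`). [folklore] -/
noncomputable def U (h N : ℕ) : ℝ :=
  ∑ n ∈ Finset.Icc 1 N, ArithmeticFunction.vonMangoldt n * Real.log n *
    (ArithmeticFunction.vonMangoldt (n + h) * Real.log ((n + h : ℕ) : ℝ))

/-- Log-weighted Hardy–Littlewood pairs at every even shift: `U_h(N) = 𝔖({0,h}) N log²N + o(N log²N)`.
VERBATIM the antecedent of the route's crux `WeightedPairsToGHL` (`weightedPairsToGHL_iff`). [folklore] -/
def WeightedPairsHL : Prop :=
  ∀ h : ℕ, 1 ≤ h → Even h →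
    (fun N : ℕ => U h N - sing h * N * Real.log N ^ 2) =o[atTop] fun N : ℕ => (N : ℝ) * Real.log N ^ 2

/-- The crux, respelled with `S` and `sing` (definitional). [folklore] -/
theorem crux_iff :
    RoughSemiprimeTwins ↔
      ∀ h : ℕ, 1 ≤ h → Even h →
        (fun N : ℕ => S h N - (1 / 4 : ℝ) * sing h * N * Real.log N ^ 2) =o[atTop]
          fun N : ℕ => (N : ℝ) * Real.log N ^ 2 :=
  Iff.rfl

/-- The route's residual crux IS `WeightedPairsHL → GHL` (definitional). [folklore] -/
theorem weightedPairsToGHL_iff :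
    WeightedPairsToGHL ↔ (WeightedPairsHL → GeneralizedHardyLittlewood) :=
  Iff.rfl

/-! ## §1 The costume theorem at pair level -/

/-- The route's mechanism, fed with its two Elliott–Halberstam-type inputs, in the named spelling:
`S_h(N) − ¼ U_h(N) = o(N log²N)` for every even `h`. [folklore] -/
theorem rigidity (hR : TwoSidedRigidity) (hEH : EH) (hB : RoughSemiprimeBombieri) :
    ∀ h : ℕ, 1 ≤ h → Even h →
      (fun N : ℕ => S h N - (1 / 4 : ℝ) * U h N) =o[atTop] fun N : ℕ => (N : ℝ) * Real.log N ^ 2 := by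
  intro h hh he
  obtain ⟨X, g, hX⟩ := hB h hh he
  exact hR hEH h hh he X g hX

/-- **Costume theorem, pair level.** Given the route's mechanism `TwoSidedRigidity` and its inputs `EH`,
`RoughSemiprimeBombieri`, the deciding crux `RoughSemiprimeTwins` is EQUIVALENT to log-weighted Hardy–Littlewood
pairs at every even shift (the twin-prime asymptotic sector of the summit). [folklore] -/
theorem crux_iff_weightedPairsHL (hR : TwoSidedRigidity) (hEH : EH) (hB : RoughSemiprimeBombieri) :
    RoughSemiprimeTwins ↔ WeightedPairsHL := by
  rw [crux_iff]
  constructor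
  · intro hT h hh he
    have h1 := rigidity hR hEH hB h hh he
    have h2 := hT h hh he
    have h3 := (h2.sub h1).const_mul_left 4
    refine h3.congr_left ?_
    intro N
    ring
  · intro hP h hh he
    have h1 := rigidity hR hEH hB h hh he
    have h2 := (hP h hh he).const_mul_left (1 / 4 : ℝ)
    refine (h1.add h2).congr_left ?_
    intro N
    ring

/-! ## §2 Abel-type upgrade: plain pair asymptotics give log-weighted ones -/

section Abel

variable {a : ℕ → ℝ}

/-- Partial sums `A(N) = Σ_{1 ≤ n ≤ N} a_n`. [folklore] -/
noncomputable def Asum (a : ℕ → ℝ) (N : ℕ) : ℝ := ∑ n ∈ Icc 1 N, a n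

/-- Log-weighted sums `T(N) = Σ_{1 ≤ n ≤ N} a_n log n log(n+h)`. [folklore] -/
noncomputable def Tsum (a : ℕ → ℝ) (h N : ℕ) : ℝ :=
  ∑ n ∈ Icc 1 N, a n * (Real.log n * Real.log ((n + h : ℕ) : ℝ))

/-- Splitting `Σ_{1 ≤ n ≤ N} = Σ_{1 ≤ n ≤ M} + Σ_{M < n ≤ N}`. [folklore] -/
theorem sum_Icc_one_split {M N : ℕ} (hMN : M ≤ N) (f : ℕ → ℝ) :
    ∑ n ∈ Icc 1 N, f n = ∑ n ∈ Icc 1 M, f n + ∑ n ∈ Ioc M N, f n := by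
  have hU : Icc 1 N = Icc 1 M ∪ Ioc M N := by
    ext n
    simp only [Finset.mem_union, Finset.mem_Icc, Finset.mem_Ioc]
    omega
  rw [hU, Finset.sum_union]
  rw [Finset.disjoint_left]
  intro n h1 h2
  simp only [Finset.mem_Icc, Finset.mem_Ioc] at h1 h2
  omega

/-- Trivial upper bound: `T(N) ≤ A(N) log N log(N+h)` for `a ≥ 0`. [folklore] -/
theorem Tsum_le (ha : ∀ n, 0 ≤ a n) (h N : ℕ) :
    Tsum a h N ≤ Asum a N * (Real.log N * Real.log ((N + h : ℕ) : ℝ)) := by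
  unfold Tsum Asum
  rw [Finset.sum_mul]
  refine Finset.sum_le_sum fun n hn => ?_
  rw [Finset.mem_Icc] at hn
  refine mul_le_mul_of_nonneg_left ?_ (ha n)
  have hn1 : (1 : ℝ) ≤ n := by exact_mod_cast hn.1
  have hnN : (n : ℝ) ≤ N := by exact_mod_cast hn.2
  have hnh : ((n + h : ℕ) : ℝ) ≤ ((N + h : ℕ) : ℝ) := by exact_mod_cast Nat.add_le_add_right hn.2 h
  have h1 : (1 : ℝ) ≤ ((n + h : ℕ) : ℝ) := by exact_mod_cast (le_trans hn.1 (Nat.le_add_right n h))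
  exact mul_le_mul (Real.log_le_log (by linarith) hnN) (Real.log_le_log (by linarith) hnh)
    (Real.log_nonneg h1) (Real.log_nonneg (by linarith))

/-- Lower bound by restriction to `n > M`: `log²(M+1) · (A(N) − A(M)) ≤ T(N)` for `a ≥ 0`, `M ≤ N`. [folklore] -/
theorem le_Tsum (ha : ∀ n, 0 ≤ a n) (h : ℕ) {M N : ℕ} (hMN : M ≤ N) :
    Real.log ((M + 1 : ℕ) : ℝ) ^ 2 * (Asum a N - Asum a M) ≤ Tsum a h N := by
  unfold Tsum Asum
  rw [sum_Icc_one_split hMN a,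
    sum_Icc_one_split hMN (fun n => a n * (Real.log n * Real.log ((n + h : ℕ) : ℝ))),
    add_sub_cancel_left, Finset.mul_sum]
  have hIoc : ∀ n ∈ Ioc M N, Real.log ((M + 1 : ℕ) : ℝ) ^ 2 * a n ≤
      a n * (Real.log n * Real.log ((n + h : ℕ) : ℝ)) := by
    intro n hn
    rw [Finset.mem_Ioc] at hn
    have hM1 : (1 : ℝ) ≤ ((M + 1 : ℕ) : ℝ) := by exact_mod_cast Nat.succ_le_succ (Nat.zero_le M)
    have hMn : ((M + 1 : ℕ) : ℝ) ≤ n := by exact_mod_cast hn.1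
    have hnh : (n : ℝ) ≤ ((n + h : ℕ) : ℝ) := by exact_mod_cast Nat.le_add_right n h
    have hL0 : 0 ≤ Real.log ((M + 1 : ℕ) : ℝ) := Real.log_nonneg hM1
    have hL1 : Real.log ((M + 1 : ℕ) : ℝ) ≤ Real.log n := Real.log_le_log (by linarith) hMn
    have hL2 : Real.log ((M + 1 : ℕ) : ℝ) ≤ Real.log ((n + h : ℕ) : ℝ) :=
      Real.log_le_log (by linarith) (le_trans hMn hnh)
    rw [mul_comm, sq]
    exact mul_le_mul_of_nonneg_left (mul_le_mul hL1 hL2 hL0 (le_trans hL0 hL1)) (ha n)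
  calc ∑ n ∈ Ioc M N, Real.log ((M + 1 : ℕ) : ℝ) ^ 2 * a n
      ≤ ∑ n ∈ Ioc M N, a n * (Real.log n * Real.log ((n + h : ℕ) : ℝ)) := Finset.sum_le_sum hIoc
    _ ≤ ∑ n ∈ Icc 1 M, a n * (Real.log n * Real.log ((n + h : ℕ) : ℝ)) +
          ∑ n ∈ Ioc M N, a n * (Real.log n * Real.log ((n + h : ℕ) : ℝ)) := by
        apply le_add_of_nonneg_left
        refine Finset.sum_nonneg fun n hn => ?_
        rw [Finset.mem_Icc] at hn
        have hn1 : (1 : ℝ) ≤ n := by exact_mod_cast hn.1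
        have h1 : (1 : ℝ) ≤ ((n + h : ℕ) : ℝ) := by
          exact_mod_cast (le_trans hn.1 (Nat.le_add_right n h))
        exact mul_nonneg (ha n) (mul_nonneg (Real.log_nonneg hn1) (Real.log_nonneg h1))

/-- `log(N + h) ≤ log N + h/N` for `N ≥ 1`. [folklore] -/
theorem log_add_le (N h : ℕ) (hN : 1 ≤ N) :
    Real.log ((N + h : ℕ) : ℝ) ≤ Real.log N + h / N := by
  have hN0 : (0 : ℝ) < N := by exact_mod_cast hN
  have hNh : (0 : ℝ) < ((N + h : ℕ) : ℝ) := by exact_mod_cast (lt_of_lt_of_le hN (Nat.le_add_right N h))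
  have key : Real.log (((N + h : ℕ) : ℝ) / N) ≤ ((N + h : ℕ) : ℝ) / N - 1 :=
    Real.log_le_sub_one_of_pos (div_pos hNh hN0)
  rw [Real.log_div hNh.ne' hN0.ne'] at key
  have : ((N + h : ℕ) : ℝ) / N - 1 = h / N := by
    push_cast
    field_simp
    ring
  linarith

set_option maxHeartbeats 800000 in
/-- **Abel-type upgrade.** If `a ≥ 0` and `Σ_{n ≤ N} a_n = cN + o(N)` then
`Σ_{n ≤ N} a_n log n log(n+h) = c N log²N + o(N log²N)`. [folklore] -/
theorem abel_logsq (ha : ∀ n, 0 ≤ a n) (c : ℝ) (h : ℕ)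
    (hA : (fun N : ℕ => Asum a N - c * N) =o[atTop] fun N : ℕ => (N : ℝ)) :
    (fun N : ℕ => Tsum a h N - c * N * Real.log N ^ 2) =o[atTop]
      fun N : ℕ => (N : ℝ) * Real.log N ^ 2 := by
  have hA' : ∀ ε : ℝ, 0 < ε → ∀ᶠ N : ℕ in atTop, |Asum a N - c * N| ≤ ε * N := by
    intro ε hε
    filter_upwards [hA.def hε] with N hN
    simpa only [Real.norm_eq_abs, Nat.abs_cast] using hN
  -- the constant is nonnegative
  have hc : 0 ≤ c := by
    by_contra hneg
    have hneg' : c < 0 := not_le.mp hneg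
    have hε : 0 < -c / 2 := by linarith
    obtain ⟨N, hN⟩ := ((hA' _ hε).and (eventually_ge_atTop 1)).exists
    have hAN : 0 ≤ Asum a N := Finset.sum_nonneg fun n _ => ha n
    have h1 := (abs_le.mp hN.1).2
    have hN1 : (1 : ℝ) ≤ N := by exact_mod_cast hN.2
    have h2 : c / 2 * (N : ℝ) ≤ c / 2 * 1 := mul_le_mul_of_nonpos_left hN1 (by linarith)
    linarith
  rw [Asymptotics.isLittleO_iff]
  intro η hη
  -- parameters
  set δ : ℝ := min (1 / 2) (η / (3 * (c + 1))) with hδ_def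
  have hδ : 0 < δ := lt_min (by norm_num) (by positivity)
  have hδ2 : δ ≤ 1 / 2 := min_le_left _ _
  have hδη : δ * (c + 1) ≤ η / 3 := by
    have : δ ≤ η / (3 * (c + 1)) := min_le_right _ _
    rw [le_div_iff₀ (by positivity)] at this
    linarith
  set ε : ℝ := η / 6 with hε_def
  have hε : 0 < ε := by positivity
  -- eventualities
  have hlog : Tendsto (fun N : ℕ => Real.log (N : ℝ)) atTop atTop :=
    Real.tendsto_log_atTop.comp tendsto_natCast_atTop_atTop
  have hMt : Tendsto (fun N : ℕ => ⌊δ * (N : ℝ)⌋₊) atTop atTop :=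
    tendsto_nat_floor_atTop.comp (tendsto_natCast_atTop_atTop.const_mul_atTop hδ)
  have E1 := hA' ε hε
  have E2 : ∀ᶠ N : ℕ in atTop,
      |Asum a ⌊δ * (N : ℝ)⌋₊ - c * ((⌊δ * (N : ℝ)⌋₊ : ℕ) : ℝ)| ≤ ε * ((⌊δ * (N : ℝ)⌋₊ : ℕ) : ℝ) :=
    hMt.eventually (hA' ε hε)
  have E3 : ∀ᶠ N : ℕ in atTop, (1 : ℝ) ≤ Real.log N := hlog.eventually_ge_atTop 1
  have E4 : ∀ᶠ N : ℕ in atTop, 2 * c * |Real.log δ| / δ ≤ Real.log N := hlog.eventually_ge_atTop _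
  have E5 : ∀ᶠ N : ℕ in atTop, (c + ε) * h ≤ ε * N :=
    (tendsto_natCast_atTop_atTop.const_mul_atTop hε).eventually_ge_atTop _
  have E6 : ∀ᶠ N : ℕ in atTop, 2 ≤ N := eventually_ge_atTop 2
  filter_upwards [E1, E2, E3, E4, E5, E6] with N h1 h2 h3 h4 h5 h6
  -- basic positivity
  have hN2 : (2 : ℝ) ≤ N := by exact_mod_cast h6
  have hN0 : (0 : ℝ) < N := by linarith
  have hL0 : 0 ≤ Real.log (N : ℝ) := by linarith
  have hL1 : 1 ≤ Real.log (N : ℝ) := h3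
  set L : ℝ := Real.log (N : ℝ) with hL_def
  have hgauge : 0 ≤ (N : ℝ) * L ^ 2 := by positivity
  rw [Real.norm_eq_abs, Real.norm_eq_abs, abs_of_nonneg hgauge, abs_le]
  constructor
  · -- lower bound: c N L² - T N ≤ η N L²
    set M : ℕ := ⌊δ * (N : ℝ)⌋₊ with hM_def
    have hM_le : (M : ℝ) ≤ δ * N := Nat.floor_le (by positivity)
    have hM_lt : δ * N ≤ (M : ℝ) + 1 := (Nat.lt_floor_add_one _).le
    have hM0 : (0 : ℝ) ≤ M := Nat.cast_nonneg M
    have hδN2 : δ * N ≤ 1 / 2 * N := mul_le_mul_of_nonneg_right hδ2 hN0.le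
    have hMN_real : (M : ℝ) + 1 ≤ N := by linarith
    have hMN' : (M : ℝ) ≤ N := by linarith
    have hMN : M ≤ N := by exact_mod_cast hMN'
    have hcast : ((M + 1 : ℕ) : ℝ) = (M : ℝ) + 1 := by push_cast; ring
    -- the logs
    have hδN : 0 < δ * N := by positivity
    set LM : ℝ := Real.log ((M + 1 : ℕ) : ℝ) with hLM_def
    have hLM_ge : Real.log δ + L ≤ LM := by
      rw [hLM_def, hcast, ← Real.log_mul hδ.ne' hN0.ne']
      exact Real.log_le_log hδN hM_lt
    have hLM_le : LM ≤ L := by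
      rw [hLM_def, hcast]
      exact Real.log_le_log (by positivity) hMN_real
    have hLM_0 : 0 ≤ LM := by
      rw [hLM_def, hcast]
      exact Real.log_nonneg (by linarith)
    have hlogδ : Real.log δ ≤ 0 := Real.log_nonpos hδ.le (by linarith)
    have habsδ : |Real.log δ| = -Real.log δ := abs_of_nonpos hlogδ
    -- the sums
    have l1 : LM ^ 2 * (Asum a N - Asum a M) ≤ Tsum a h N := le_Tsum ha h hMN
    have hAN : c * N - ε * N ≤ Asum a N := by linarith [(abs_le.mp h1).1]
    have hAM : Asum a M ≤ c * M + ε * M := by linarith [(abs_le.mp h2).2]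
    have hεM : ε * M ≤ ε * N := mul_le_mul_of_nonneg_left hMN' hε.le
    have hX : c * (N - M) - 2 * ε * N ≤ Asum a N - Asum a M := by linarith
    have l2 : LM ^ 2 * (c * (N - M) - 2 * ε * N) ≤ LM ^ 2 * (Asum a N - Asum a M) :=
      mul_le_mul_of_nonneg_left hX (sq_nonneg _)
    -- c N L² - LM²·(c(N-M) - 2εN) = cN(L² - LM²) + c M LM² + 2 ε N LM²
    have hsq : L ^ 2 - LM ^ 2 ≤ 2 * |Real.log δ| * L := by
      have hd1 : L - LM ≤ -Real.log δ := by linarith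
      have hs1 : L + LM ≤ 2 * L := by linarith
      have hs2 : 0 ≤ L + LM := by linarith
      calc L ^ 2 - LM ^ 2 = (L - LM) * (L + LM) := by ring
        _ ≤ (-Real.log δ) * (2 * L) := mul_le_mul hd1 hs1 hs2 (by linarith)
        _ = 2 * |Real.log δ| * L := by rw [habsδ]; ring
    have hLsq : LM ^ 2 ≤ L ^ 2 := by
      have := mul_le_mul hLM_le hLM_le hLM_0 hL0
      calc LM ^ 2 = LM * LM := sq LM
        _ ≤ L * L := this
        _ = L ^ 2 := (sq L).symm
    have t1 : c * N * (L ^ 2 - LM ^ 2) ≤ c * N * (2 * |Real.log δ| * L) :=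
      mul_le_mul_of_nonneg_left hsq (by positivity)
    have t4 : 2 * c * |Real.log δ| * L ≤ δ * L ^ 2 := by
      have h4' : 2 * c * |Real.log δ| ≤ δ * L := by
        rw [div_le_iff₀ hδ] at h4
        linarith
      have := mul_le_mul_of_nonneg_right h4' hL0
      calc 2 * c * |Real.log δ| * L ≤ δ * L * L := this
        _ = δ * L ^ 2 := by ring
    have t14 : c * N * (2 * |Real.log δ| * L) ≤ N * (δ * L ^ 2) := by
      have := mul_le_mul_of_nonneg_left t4 hN0.le
      calc c * N * (2 * |Real.log δ| * L) = N * (2 * c * |Real.log δ| * L) := by ring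
        _ ≤ N * (δ * L ^ 2) := this
    have t2 : c * M * LM ^ 2 ≤ c * (δ * N) * L ^ 2 := by
      have hcM : c * M ≤ c * (δ * N) := mul_le_mul_of_nonneg_left hM_le hc
      exact mul_le_mul hcM hLsq (sq_nonneg _) (by positivity)
    have t3 : 2 * ε * N * LM ^ 2 ≤ 2 * ε * N * L ^ 2 :=
      mul_le_mul_of_nonneg_left hLsq (by positivity)
    have t5 : (δ * (c + 1) + 2 * ε) * (N * L ^ 2) ≤ η * (N * L ^ 2) := by
      apply mul_le_mul_of_nonneg_right _ hgauge
      rw [hε_def]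
      linarith
    have e1 : c * N * L ^ 2 - LM ^ 2 * (c * (N - M) - 2 * ε * N) =
        c * N * (L ^ 2 - LM ^ 2) + c * M * LM ^ 2 + 2 * ε * N * LM ^ 2 := by ring
    have key : c * N * L ^ 2 - Tsum a h N ≤ (δ * (c + 1) + 2 * ε) * (N * L ^ 2) := by
      linarith
    linarith
  · -- upper bound: T N - c N L² ≤ η N L²
    have u1 := Tsum_le ha h N
    have hAN : Asum a N ≤ (c + ε) * N := by linarith [(abs_le.mp h1).2]
    have hLh0 : 0 ≤ Real.log ((N + h : ℕ) : ℝ) :=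
      Real.log_nonneg (by exact_mod_cast (le_trans (by omega : 1 ≤ N) (Nat.le_add_right N h)))
    set Lh : ℝ := Real.log ((N + h : ℕ) : ℝ) with hLh_def
    have u2 : Asum a N * (L * Lh) ≤ (c + ε) * N * (L * Lh) :=
      mul_le_mul_of_nonneg_right hAN (mul_nonneg hL0 hLh0)
    have u3 : Lh ≤ L + h / N := log_add_le N h (by omega)
    have u4 : (c + ε) * N * (L * Lh) ≤ (c + ε) * N * (L * (L + h / N)) := by
      apply mul_le_mul_of_nonneg_left _ (by positivity)
      exact mul_le_mul_of_nonneg_left u3 hL0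
    have u5 : (c + ε) * N * (L * (L + h / N)) = (c + ε) * N * L ^ 2 + (c + ε) * h * L := by
      first | (field_simp; ring) | field_simp
    have u6 : (c + ε) * h * L ≤ ε * N * L ^ 2 := by
      have e2 : (c + ε) * h * L ≤ ε * N * L := mul_le_mul_of_nonneg_right h5 hL0
      have e3 : ε * N * L * 1 ≤ ε * N * L * L := mul_le_mul_of_nonneg_left hL1 (by positivity)
      calc (c + ε) * h * L ≤ ε * N * L := e2
        _ = ε * N * L * 1 := by ring
        _ ≤ ε * N * L * L := e3
        _ = ε * N * L ^ 2 := by ring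
    have u7 : (2 * ε) * (N * L ^ 2) ≤ η * (N * L ^ 2) := by
      apply mul_le_mul_of_nonneg_right _ hgauge
      rw [hε_def]; linarith
    linarith

end Abel

/-! ## §3 The log-weighted pair slice of GHL, and the costume theorem at summit level -/

/-- **GHL gives log-weighted Hardy–Littlewood pairs** (`d = 1`, `t = 2`, slope 1, every shift `h ≥ 1`, in the
log-weighted normalisation of the route): the landed pair slice `pairAsymptotic_of_generalizedHardyLittlewood`
upgraded by `abel_logsq`. Stated as the route-side Prop `WeightedPairsHL`. [cite: GreenTao2010, Conj. 1.2] -/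
theorem weightedPairsHL_of_generalizedHardyLittlewood (hG : GeneralizedHardyLittlewood) : WeightedPairsHL := by
  intro h hh _he
  have hP := Theorems.PairsToGHL.pairAsymptotic_of_generalizedHardyLittlewood hG hh
  have key := abel_logsq (a := fun n => ArithmeticFunction.vonMangoldt n * ArithmeticFunction.vonMangoldt (n + h))
    (fun n => mul_nonneg ArithmeticFunction.vonMangoldt_nonneg ArithmeticFunction.vonMangoldt_nonneg)
    (sing h) h hP
  refine key.congr_left ?_
  intro N
  unfold Tsum U
  congr 1
  exact Finset.sum_congr rfl fun n _ => by ring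

/-- **Costume theorem, summit level.** Given the route's other four load-bearing binders, the deciding crux
`RoughSemiprimeTwins` is EQUIVALENT to the sub-problem statement `GeneralizedHardyLittlewood`:
`→` is the route's deciding theorem `closes`; `←` is the log-weighted pair slice of GHL fed back through the
rigidity. [folklore] -/
theorem crux_iff_summit (hR : TwoSidedRigidity) (hEH : EH) (hB : RoughSemiprimeBombieri)
    (hG : WeightedPairsToGHL) : RoughSemiprimeTwins ↔ GeneralizedHardyLittlewood :=
  ⟨fun hT => closes hR hEH hB hT hG,
    fun hS => (crux_iff_weightedPairsHL hR hEH hB).2 (weightedPairsHL_of_generalizedHardyLittlewood hS)⟩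

/-- The residual `WeightedPairsHL → GHL` is implied by the summit outright (a consequence of `S` used toward `S`);
stated in the unfolded spelling of `weightedPairsToGHL_iff` so as not to pose as a proof of the item. [folklore] -/
theorem residual_of_summit (hS : GeneralizedHardyLittlewood) : WeightedPairsHL → GeneralizedHardyLittlewood :=
  fun _ => hS

/-- Hence, modulo the three "mechanism + inputs" binders alone, crux ∧ residual ↔ summit: the two open research
binders of `closes` are JOINTLY the summit, and the residual is trivial given the summit. [folklore] -/
theorem crux_and_residual_iff_summit (hR : TwoSidedRigidity) (hEH : EH) (hB : RoughSemiprimeBombieri) :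
    (RoughSemiprimeTwins ∧ WeightedPairsToGHL) ↔ GeneralizedHardyLittlewood :=
  ⟨fun h => closes hR hEH hB h.1 h.2,
    fun hS => ⟨(crux_iff_summit hR hEH hB (weightedPairsToGHL_iff.2 (residual_of_summit hS))).2 hS,
      weightedPairsToGHL_iff.2 (residual_of_summit hS)⟩⟩

/-! ## §4 Why no language switch has teeth: the weight `W` is parity-pure -/

/-- Every integer carrying `W`-mass is a product of EXACTLY two primes: `W(m) ≠ 0 → Ω(m) = 2`. So `λ ≡ +1` on the
support of `W` (`liouville_eq_one_of_W_ne_zero`): the rough-semiprime cell is a pure even-parity cell, the case in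
which Bombieri's one-parameter indeterminacy (`Literature.NumberTheory.Sieve.bombieri_asymptotic_sieve_indeterminacy_holds`)
bites with full strength. [folklore] -/
theorem cardFactors_eq_two_of_W_ne_zero {m : ℕ} (hm : W m ≠ 0) : ArithmeticFunction.cardFactors m = 2 := by
  unfold W at hm
  obtain ⟨q, hq, hne⟩ := Finset.exists_ne_zero_of_sum_ne_zero hm
  rw [Nat.mem_primeFactors] at hq
  have hcond : (m / q).Prime ∧ q < m / q ∧ m < q ^ 4 := by
    by_contra hc
    exact hne (if_neg hc)
  have hmq : m = q * (m / q) := (Nat.mul_div_cancel' hq.2.1).symm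
  rw [hmq, ArithmeticFunction.cardFactors_mul hq.1.ne_zero hcond.1.ne_zero,
    ArithmeticFunction.cardFactors_apply_prime hq.1, ArithmeticFunction.cardFactors_apply_prime hcond.1]

/-- `λ(m) = 1` whenever `W(m) ≠ 0`. [folklore] -/
theorem liouville_eq_one_of_W_ne_zero {m : ℕ} (hm : W m ≠ 0) : ArithmeticFunction.liouville m = 1 := by
  have h2 := cardFactors_eq_two_of_W_ne_zero hm
  have hm0 : m ≠ 0 := by
    rintro rfl
    simp [W] at hm
  rw [ArithmeticFunction.liouville_apply hm0, h2]
  norm_num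

end Summit.Parity.GeneralizedHardyLittlewood.Cruxes.RoughSemiprimeTwins.StrategyCensus
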